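import Literature.AlgebraicGeometry.Frobenioids.ArchimedeanThm36viInstances
import Literature.AlgebraicGeometry.Frobenioids.Thm36SubInstancesA
import Mathlib.CategoryTheory.Products.Basic
import Mathlib.CategoryTheory.Discrete.Basic
import HarnessLib

/-!
# Frobenioids II, Theorem 3.6 (vi) at `C^Λ` and `A`: the universal closure of the INSTANCE statement
# `ArchFrd.Thm36vi_CA π pf rlf` is false (finding T36vi-F1 made a kernel theorem); the instance forms that hold

Mochizuki, *The geometry of Frobenioids II: poly-Frobenioids*, Kyushu J. Math. **62** (2008) 401–460, §3,
Theorem 3.6 (vi), author's kurims text p. 37 [cite: MochizukiFrdII2008, Thm 3.6 (vi) p.37]: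

> "(vi) If `D` admits a pseudo-terminal object, then `F` admits a pseudo-terminal object."

(for `F ∈ {C^Λ, A}` of Example 3.3; pseudo-terminal = [FrdI] §0 p. 14, `IsPseudoTerminal`).

The statement file `ArchimedeanTheoremsInstances.lean` (seat abc-iut-L1-t9) types the claim at the data of
Example 3.3 as `ArchFrd.Thm36vi_CA π pf rlf := (∀ Λ, Thm36vi D (C^Λ)) ∧ Thm36vi D A`, where `C^ℤ = C π` but
`C^ℚ := pf.cat`, `C^ℝ := rlf.cat` are read off two FREE binders `pf rlf : ArchFrd.LambdaCompletion π` — the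
INTERFACE "a category with a pre-Frobenioid structure over `D` and a functor from `C` lying over `D`"
(`AngularFrobenioidsRelative.lean`), typed before THE perfection / realification of `C` were constructed
(they now are: `ArchFrd.Thm36Sub.pfCompletion π hF`, `ArchFrd.Thm36Sub.rlfCompletion π`, seat lineage
w4-d100 / `Thm36Sub*.lean`).  PROOF-ONLY census of that instance row (abc-iut cell, block F fact-proving wave,
seat abc-iut-f-012; FACT-LIST row F-0882 `Thm36vi_CA`, class `preparatory`, kernel_closedness `parametrised`):

* `ArchFrd.not_forall_thm36vi_CA` — **the universal closure over `(D, π, pf, rlf)` is FALSE**: finding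
  T36vi-F1 of `ArchimedeanThm36viInstances.lean` ("a junk `pf` whose category has no pseudo-terminal object
  over a base that has one refutes `Thm36vi D pf.cat`") as a kernel theorem.  Witness
  (`exists_pf_not_thm36vi_CA`, `exists_rlf_not_thm36vi_CA`): over the base `D := D₀` itself (`π := 𝟭`;
  `Spec ℝ` is pseudo-terminal, `D0.isPseudoTerminal_real`) the SPLIT completion datum — category
  `C × Discrete Bool` (two disjoint copies of `C = C₀ ×_{D₀} D₀`), structure functor through the first
  projection, `C → C × Discrete Bool` the inclusion of the copy `false`, lying over `D₀` on the nose — is a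
  term of the interface type `LambdaCompletion (𝟭 D₀)`, and its category has NO pseudo-terminal object (the
  two copies are not connected by any arrow; `not_isPseudoTerminal_prod_discrete`).  What the witness
  exploits: the binders `pf`, `rlf` range over ALL interface data, in particular over disconnected
  categories, whereas print's `C^pf`, `C^rlf` are (connected) Frobenioids; nothing is said about print.
* Instance forms that HOLD (cited BY NAME, nothing restated): `ArchFrd.thm36vi_C`, `ArchFrd.thm36vi_A`
  (seat abc-iut-L1-t9, `ArchimedeanPseudoTerminal.lean`: (vi) for `C` and `A` over EVERY base);
  `ArchFrd.thm36vi_CA_Z` (the `Λ = ℤ` conjunct, every datum); `ArchFrd.thm36vi_CA_self` (the instance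
  statement at the trivial data `pf = rlf = C`, every base); `ArchFrd.Thm36Sub.thm36vi_CA_holds` (the
  instance statement at THE data `pfCompletion π hF`, `rlfCompletion π`, every base whose `C` is a
  Frobenioid) — assembled in `thm36vi_CA_schema_census`.

So F-0882 is admissible ONLY in its instance forms (FACT-LIST class «universal-closure REFUTED; instance
form PROVED»).  No definition, no instance (the split datum is an inline structure term); no statement of
the paper is re-typed or strengthened; a refuted universal closure of OUR typing's binders is a statement
about the typing, not about [FrdII]; nothing here bears on [IUTchIII] Cor. 3.12 or takes a side; typed ≠
proved except where a `theorem` says so.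
-/

namespace Literature.AlgebraicGeometry.Frobenioids

open CategoryTheory

noncomputable section

universe v u

namespace ArchFrd

/-! ### The two halves of the witness -/

/-- `Spec ℝ` is a pseudo-terminal object of `D₀` ([FrdI] §0 p. 14): `Spec ℂ → Spec ℝ` and `id_{Spec ℝ}`.
[cite: MochizukiFrdII2008, §3 p.23] -/
theorem D0.isPseudoTerminal_real : IsPseudoTerminal D0.real := fun B => by
  cases B with
  | real => exact ⟨𝟙 _⟩
  | complex => exact ⟨D0.toRealHom⟩

/-- In the product of any category with the two-object discrete category NO object is pseudo-terminal:
the object in the other copy admits no arrow to it. [cite: MochizukiFrdI2008, §0 p.14] -/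
theorem not_isPseudoTerminal_prod_discrete {X : Type u} [Category.{v} X] (T : X × Discrete Bool) :
    ¬ IsPseudoTerminal T := by
  intro hT
  obtain ⟨f⟩ := hT (T.1, ⟨!T.2.as⟩)
  have h : (!T.2.as) = T.2.as := Discrete.eq_of_hom f.2
  revert h
  cases T.2.as <;> decide

/-! ### The universal closure of the instance statement `Thm36vi_CA` is false -/

variable {D : Type u} [Category.{v} D] (π : D ⥤ D0)

/-- Over ANY base `π : D → D₀`: the `Λ = ℚ` slot alone refutes the closure — there is a completion datum
`pf : LambdaCompletion π` (the split datum `C × Discrete Bool`, structure through the first projection)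
with `¬ Thm36vi_CA π pf rlf` for every `rlf`, as soon as `D` has a pseudo-terminal object.
[cite: MochizukiFrdII2008, Thm 3.6 (vi) p.37] -/
theorem exists_pf_not_thm36vi_CA_of (hD : ∃ B : D, IsPseudoTerminal B) (rlf : LambdaCompletion π) :
    ∃ pf : LambdaCompletion π,
      ¬ Literature.AlgebraicGeometry.Frobenioids.ArchFrd.Thm36vi_CA π pf rlf := by
  refine ⟨{ cat := C π × Discrete Bool
            monoid := Φ π
            str := CategoryTheory.Prod.fst (C π) (Discrete Bool) ⋙ C.toElem π
            fromC := (𝟭 (C π)).prod' ((Functor.const (C π)).obj ⟨false⟩)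
            over := rfl }, fun h => ?_⟩
  obtain ⟨T, hT⟩ := ((thm36vi_CA_iff π _ rlf).1 h).1 hD
  exact not_isPseudoTerminal_prod_discrete T hT

/-- Symmetrically, the `Λ = ℝ` slot alone refutes the closure. [cite: MochizukiFrdII2008, Thm 3.6 (vi) p.37] -/
theorem exists_rlf_not_thm36vi_CA_of (hD : ∃ B : D, IsPseudoTerminal B) (pf : LambdaCompletion π) :
    ∃ rlf : LambdaCompletion π,
      ¬ Literature.AlgebraicGeometry.Frobenioids.ArchFrd.Thm36vi_CA π pf rlf := by
  refine ⟨{ cat := C π × Discrete Bool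
            monoid := Φ π
            str := CategoryTheory.Prod.fst (C π) (Discrete Bool) ⋙ C.toElem π
            fromC := (𝟭 (C π)).prod' ((Functor.const (C π)).obj ⟨false⟩)
            over := rfl }, fun h => ?_⟩
  obtain ⟨T, hT⟩ := ((thm36vi_CA_iff π pf _).1 h).2 hD
  exact not_isPseudoTerminal_prod_discrete T hT

/-- **Closed refuting instance with head `Thm36vi_CA`**, over `D₀` itself (`π := 𝟭 D₀`, `Spec ℝ`
pseudo-terminal): some completion datum `pf` falsifies the instance statement, with `rlf := C` the trivial
datum. [cite: MochizukiFrdII2008, Thm 3.6 (vi) p.37] -/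
theorem exists_pf_not_thm36vi_CA :
    ∃ pf : LambdaCompletion (𝟭 D0),
      ¬ Literature.AlgebraicGeometry.Frobenioids.ArchFrd.Thm36vi_CA (𝟭 D0) pf (LambdaCompletion.self _) :=
  exists_pf_not_thm36vi_CA_of (𝟭 D0) ⟨D0.real, D0.isPseudoTerminal_real⟩ _

/-- The same with the roles of `pf` and `rlf` exchanged. [cite: MochizukiFrdII2008, Thm 3.6 (vi) p.37] -/
theorem exists_rlf_not_thm36vi_CA :
    ∃ rlf : LambdaCompletion (𝟭 D0),
      ¬ Literature.AlgebraicGeometry.Frobenioids.ArchFrd.Thm36vi_CA (𝟭 D0) (LambdaCompletion.self _) rlf :=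
  exists_rlf_not_thm36vi_CA_of (𝟭 D0) ⟨D0.real, D0.isPseudoTerminal_real⟩ _

/-- **The universal closure of the instance statement `ArchFrd.Thm36vi_CA` is FALSE** (FACT-LIST F-0882:
not an admissible hypothesis as a closure; instance forms only — finding T36vi-F1 in kernel form).  The
binders are exactly those of the declaration (`D`, `π`, `pf`, `rlf`), at universe level `0`.
[cite: MochizukiFrdII2008, Thm 3.6 (vi) p.37] -/
theorem not_forall_thm36vi_CA :
    ¬ ∀ (D : Type) [Category.{0} D] (π : D ⥤ D0) (pf rlf : LambdaCompletion π),
        Literature.AlgebraicGeometry.Frobenioids.ArchFrd.Thm36vi_CA π pf rlf := by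
  intro h
  obtain ⟨pf, hpf⟩ := exists_pf_not_thm36vi_CA
  exact hpf (h D0 (𝟭 D0) pf (LambdaCompletion.self _))

/-! ### The instance forms that hold (by name) -/

/-- **Census of F-0882** (`Thm36vi_CA`): the universal closure is false, while the instance statement HOLDS
(i) at the trivial completion data `pf = rlf = C` over every base (`thm36vi_CA_self`), (ii) at THE data —
the perfection `pfCompletion π hF` and the realification `rlfCompletion π` — over every base whose `C` is a
Frobenioid (`Thm36Sub.thm36vi_CA_holds`), and (iii) its `Λ = ℤ` and `A` conjuncts hold for every datum
(`thm36vi_CA_Z` = `thm36vi_C`, `thm36vi_A`). [cite: MochizukiFrdII2008, Thm 3.6 (vi) p.37] -/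
theorem thm36vi_CA_schema_census (pf rlf : LambdaCompletion π)
    (hF : PreFrobenioid.IsFrobenioid (C.toElem π)) :
    (¬ ∀ (D : Type) [Category.{0} D] (π : D ⥤ D0) (pf rlf : LambdaCompletion π),
        Literature.AlgebraicGeometry.Frobenioids.ArchFrd.Thm36vi_CA π pf rlf) ∧
      Literature.AlgebraicGeometry.Frobenioids.ArchFrd.Thm36vi_CA π (LambdaCompletion.self π)
          (LambdaCompletion.self π) ∧
        Literature.AlgebraicGeometry.Frobenioids.ArchFrd.Thm36vi_CA π (Thm36Sub.pfCompletion π hF)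
          (Thm36Sub.rlfCompletion π) ∧
          Thm36vi D (archFrobenioid π pf rlf MonoidType.Z).cat ∧ Thm36vi D (A π) :=
  ⟨not_forall_thm36vi_CA, thm36vi_CA_self π, Thm36Sub.thm36vi_CA_holds π hF, thm36vi_CA_Z π pf rlf,
    thm36vi_A π⟩

end ArchFrd

end

end Literature.AlgebraicGeometry.Frobenioids
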